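import Summits.Ventures.YMGap.RobustBall.RowsSMassive
import Summits.Ventures.YMGap.RobustBall.IsotropicPairWitness
import Summits.Ventures.YMGap.RobustBall.SuperposedWitnessRows
import Summits.Ventures.YMGap.RobustBall.RowsSN
import HarnessLib

/-!
# Venture YMGap, track ROBUST-BALL (tier 2) — the two-plaquette NORM BALL, the ISOTROPIC infinite-range member
# and the SUPERPOSED member: every DLR state is MASSIVE

HONEST FRAMING. WHAT THIS IS: a venture file (cell `pub-ymgap`, track Y2 ROBUST-BALL, seat ds-3): the MASSIVE
reading of three of rb-p1's tier-2 witnesses, with rb-p1's membership theorems and load arithmetic VERBATIM and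
the seat's massive cells (`RowsSMassive.lean`) in place of the clustering rows:
* the norm ball of two-plaquette couplings `J : ZdPlaquette 4 × ZdPlaquette 4 → ℝ` (`PairCoupling.lean`,
  `memBallZdS_plaqPairCoupling`; row/column norms `S₀ = K₀ + K₀'`, weighted `S_t = K_t + K_t'`): `SU(2)` at
  `β_W = 1/16`, `S₀ ≤ 7/2000`, `S_{log 3/2} ≤ 11/2000` ⇒ DLR states exist and EVERY DLR state is an
  Osterwalder–Seiler MASSIVE STATE with plaquette–plaquette decay (`su2_pairCoupling_massive_1_16`); ALL `N ≥ 2` at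
  coupling `1/64`, `S₀, S_{log 6/5} ≤ 1/400`, hypothesis-free (`suN_pairCoupling_massive_1_64`);
* the ISOTROPIC member `isotropicPairWitness N τ (1/10)` — ALL ordered pairs of plaquettes coupled by
  `τ (1/10)^{‖x_p − x_q‖₁} (Re tr U_p/N)(Re tr U_q/N)`, in NO tier-1 ball (`not_memBallZd_isotropicPairWitness`):
  `SU(2)` at `β_W = 1/16`, `|τ| ≤ 1/10000` ⇒ every DLR state massive (`su2_isotropicPair_massive_1_16`); NEW
  all-`N` cells at coupling `1/64`, `|τ| ≤ 1/12000`: clustering row `suN_isotropicPair_massGapS_1_64`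
  (`PerturbedMassGapAtS`, rb-p1's currency, inside `suN_rowS_1_64`) and its massive twin
  `suN_isotropicPair_massive_1_64` (loads `a ≤ 0.0268 ≤ 1/20`, `Λ ≤ 0.0989 ≤ 1/10` with `√N ≥ √2 ≥ 1.41421`);
* the SUPERPOSED member `adjointWitness t + axialPairWitness 2 τ (1/10)` (`SuperposedWitnessRows.lean`,
  `MemBallZdS.add`): `SU(2)` at `β_W = 1/16`, `|t| ≤ 1/1000`, `|τ| ≤ 1/500` ⇒ every DLR state massive
  (`su2_adjoint_add_axialPair_massive_1_16`).
DOOR-LEVEL, same certificates as rb-p1's rows. WHAT IT IS NOT: no new radius for the `SU(2)` rows (the all-`N`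
isotropic bound `1/12000` is new, door arithmetic only); strong-coupling lattice statements; nothing about the
continuum limit, confinement or the Clay Millennium problem.

References: rb-p1 `PairCoupling.lean`, `PairCouplingRows.lean`, `IsotropicPairWitness.lean`,
`SuperposedWitnessRows.lean`, `RowsS.lean`, `RowsSN.lean`; ds-3 `RowsSMassive.lean`; K. Osterwalder, E. Seiler,
Ann. Phys. 110 (1978) 440, §4.
-/

noncomputable section

open MeasureTheory ProbabilityTheory Function Finset Filter Topology Real
open scoped NNReal
open Literature.Probability.LatticeModels
open Literature.MathematicalPhysics.QuantumLattice
open Literature.MathematicalPhysics.QuantumFieldTheory hiding ZdEdge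
open Literature.Barriers.QuantumFields (IsMassiveState)

namespace Summit.Ventures.YMGap.RobustBall

variable {N : ℕ} {J : PlaqPairIdx 4 → ℝ}

/-! ### The norm ball of two-plaquette couplings -/

/-- ★ **`SU(2)`, `ℤ⁴`, `β_W = 1/16`: every DLR state MASSIVE uniformly on the norm ball `S₀ ≤ 7/2000`,
`S_{log 3/2} ≤ 11/2000` of two-plaquette couplings** (the hypotheses of rb-p1's `su2_pairCoupling_massGapS_1_16`
verbatim): the perturbed theory `S_W + ∑ J(p,q)(Re tr U_p/2)(Re tr U_q/2)` has DLR states and every DLR state is an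
Osterwalder–Seiler massive state (rate `log (3/2)`) with plaquette–plaquette decay (massive cell
`su2_massiveS_rowS32_1_16`; loads `a = 12 S₀ ≤ 0.042`, `Λ = 24((3/2)S₀ + S_t)/√2 ≤ 0.1825 ≤ 0.186`). -/
theorem su2_pairCoupling_massive_1_16 {K₀ K₀' Kt Kt' : ℝ} (hK₀ : 0 ≤ K₀) (hK₀' : 0 ≤ K₀') (hKt : 0 ≤ Kt)
    (hKt' : 0 ≤ Kt')
    (hrow₀ : ∀ p, Summable fun q => |J (p, q)|) (hrowK₀ : ∀ p, ∑' q, |J (p, q)| ≤ K₀)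
    (hcol₀ : ∀ q, Summable fun p => |J (p, q)|) (hcolK₀ : ∀ q, ∑' p, |J (p, q)| ≤ K₀')
    (hrowt : ∀ p, Summable fun q => |J (p, q)| * exp (Real.log (3 / 2) * (‖p.1 - q.1‖ + 1)))
    (hrowKt : ∀ p, ∑' q, |J (p, q)| * exp (Real.log (3 / 2) * (‖p.1 - q.1‖ + 1)) ≤ Kt)
    (hcolt : ∀ q, Summable fun p => |J (p, q)| * exp (Real.log (3 / 2) * (‖p.1 - q.1‖ + 1)))
    (hcolKt : ∀ q, ∑' p, |J (p, q)| * exp (Real.log (3 / 2) * (‖p.1 - q.1‖ + 1)) ≤ Kt')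
    (hS₀ : K₀ + K₀' ≤ 7 / 2000) (hSt : Kt + Kt' ≤ 11 / 2000) :
    (perturbedGibbsMeasuresS (d := 4) (fundamentalRep (Fin 2)) (((2 : ℕ) : ℝ) * ((1 / 16 : ℝ) / 4))
        (plaqPairCoupling (d := 4) 2 J)).Nonempty ∧
      ∀ μ ∈ perturbedGibbsMeasuresS (d := 4) (fundamentalRep (Fin 2)) (((2 : ℕ) : ℝ) * ((1 / 16 : ℝ) / 4))
          (plaqPairCoupling (d := 4) 2 J),
        IsMassiveState μ ∧ HasExponentialDecay (plaquetteCorrFn (fundamentalRep (Fin 2)) μ) := by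
  have hq : exp (Real.log (3 / 2)) = 3 / 2 := Real.exp_log (by norm_num)
  have hmem := memBallZdS_plaqPairCoupling (d := 4) (N := 2) (J := J) (by norm_num) (by norm_num)
    (Real.log_nonneg (by norm_num)) hK₀ hK₀' hKt hKt' hrow₀ hrowK₀ hcol₀ hcolK₀ hrowt hrowKt hcolt hcolKt
  rw [hq] at hmem
  have hs := sqrt_two_ge
  have hs0 : (0 : ℝ) < Real.sqrt 2 := by linarith
  have hnum : 0 ≤ 3 / 2 * (K₀ + K₀') + (Kt + Kt') := by positivity
  have hdiv : (3 / 2 * (K₀ + K₀') + (Kt + Kt')) / Real.sqrt 2 ≤ (3 / 2 * (7 / 2000) + 11 / 2000) / (141421 / 100000) :=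
    div_le_div₀ (by norm_num) (by linarith) (by norm_num) hs
  refine su2_massiveS_rowS32_1_16 (hmem.mono ?_ ?_)
  · push_cast; nlinarith
  · push_cast
    have heq : (8 : ℝ) * (4 - 1) * (3 / 2 * (K₀ + K₀') + (Kt + Kt')) / Real.sqrt 2 =
        24 * ((3 / 2 * (K₀ + K₀') + (Kt + Kt')) / Real.sqrt 2) := by ring
    rw [heq]
    nlinarith [hdiv]

/-- ★ **ALL `N ≥ 2`, `ℤ⁴`, coupling `β = 1/64`, HYPOTHESIS-FREE: every DLR state MASSIVE uniformly on the norm ball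
`S₀ ≤ 1/400`, `S_{log 6/5} ≤ 1/400` of two-plaquette couplings** (the hypotheses of rb-p1's
`suN_pairCoupling_massGapS_1_64` verbatim; massive cell `suN_massiveS_rowS_1_64`; loads `a = 12 S₀ ≤ 0.03 ≤ 1/20`,
`Λ = 24((6/5)S₀ + S_t)/√N ≤ 0.0934 ≤ 1/10`). -/
theorem suN_pairCoupling_massive_1_64 (hN : 2 ≤ N) {K₀ K₀' Kt Kt' : ℝ} (hK₀ : 0 ≤ K₀) (hK₀' : 0 ≤ K₀')
    (hKt : 0 ≤ Kt) (hKt' : 0 ≤ Kt')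
    (hrow₀ : ∀ p, Summable fun q => |J (p, q)|) (hrowK₀ : ∀ p, ∑' q, |J (p, q)| ≤ K₀)
    (hcol₀ : ∀ q, Summable fun p => |J (p, q)|) (hcolK₀ : ∀ q, ∑' p, |J (p, q)| ≤ K₀')
    (hrowt : ∀ p, Summable fun q => |J (p, q)| * exp (Real.log (6 / 5) * (‖p.1 - q.1‖ + 1)))
    (hrowKt : ∀ p, ∑' q, |J (p, q)| * exp (Real.log (6 / 5) * (‖p.1 - q.1‖ + 1)) ≤ Kt)
    (hcolt : ∀ q, Summable fun p => |J (p, q)| * exp (Real.log (6 / 5) * (‖p.1 - q.1‖ + 1)))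
    (hcolKt : ∀ q, ∑' p, |J (p, q)| * exp (Real.log (6 / 5) * (‖p.1 - q.1‖ + 1)) ≤ Kt')
    (hS₀ : K₀ + K₀' ≤ 1 / 400) (hSt : Kt + Kt' ≤ 1 / 400) :
    (perturbedGibbsMeasuresS (d := 4) (fundamentalRep (Fin N)) ((N : ℝ) * (1 / 64))
        (plaqPairCoupling (d := 4) N J)).Nonempty ∧
      ∀ μ ∈ perturbedGibbsMeasuresS (d := 4) (fundamentalRep (Fin N)) ((N : ℝ) * (1 / 64))
          (plaqPairCoupling (d := 4) N J),
        IsMassiveState μ ∧ HasExponentialDecay (plaquetteCorrFn (fundamentalRep (Fin N)) μ) := by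
  have hq : exp (Real.log (6 / 5)) = 6 / 5 := Real.exp_log (by norm_num)
  have hmem := memBallZdS_plaqPairCoupling (d := 4) (N := N) (J := J) (by norm_num) (by omega)
    (Real.log_nonneg (by norm_num)) hK₀ hK₀' hKt hKt' hrow₀ hrowK₀ hcol₀ hcolK₀ hrowt hrowKt hcolt hcolKt
  rw [hq] at hmem
  have hN2 : (2 : ℝ) ≤ N := by exact_mod_cast hN
  have hs : (141421 / 100000 : ℝ) ≤ Real.sqrt N := sqrt_two_ge.trans (Real.sqrt_le_sqrt hN2)
  have hs0 : (0 : ℝ) < Real.sqrt N := by linarith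
  have hnum : 0 ≤ 6 / 5 * (K₀ + K₀') + (Kt + Kt') := by positivity
  have hdiv : (6 / 5 * (K₀ + K₀') + (Kt + Kt')) / Real.sqrt N ≤ (6 / 5 * (1 / 400) + 1 / 400) / (141421 / 100000) :=
    div_le_div₀ (by norm_num) (by linarith) (by norm_num) hs
  refine suN_massiveS_rowS_1_64 hN (hmem.mono ?_ ?_)
  · push_cast; nlinarith
  · push_cast
    have heq : (8 : ℝ) * (4 - 1) * (6 / 5 * (K₀ + K₀') + (Kt + Kt')) / Real.sqrt N =
        24 * ((6 / 5 * (K₀ + K₀') + (Kt + Kt')) / Real.sqrt N) := by ring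
    rw [heq]
    nlinarith [hdiv]

/-! ### The isotropic infinite-range member -/

/-- ★ **The ISOTROPIC infinite-range member at `β_W = 1/16`, `|τ| ≤ 1/10000`: every DLR state is MASSIVE**:
`SU(2)` on `ℤ⁴` at Wilson coupling `1/16` plus ALL plaquette-pair couplings
`τ (1/10)^{‖x_p − x_q‖₁} (Re tr U_p/2)(Re tr U_q/2)` has DLR states, and every DLR state is an Osterwalder–Seiler
massive state (rate `log (3/2)`) with plaquette–plaquette decay — the member lies in the ball of the massive cell
`su2_massiveS_rowS32_1_16` (loads as in rb-p1's `su2_isotropicPair_massGapS_1_16`: `a ≤ 0.0322`, `Λ ≤ 0.1706`). -/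
theorem su2_isotropicPair_massive_1_16 {τ : ℝ} (hτ : |τ| ≤ 1 / 10000) :
    (perturbedGibbsMeasuresS (d := 4) (fundamentalRep (Fin 2)) (((2 : ℕ) : ℝ) * ((1 / 16 : ℝ) / 4))
        (isotropicPairWitness (d := 4) 2 τ (1 / 10))).Nonempty ∧
      ∀ μ ∈ perturbedGibbsMeasuresS (d := 4) (fundamentalRep (Fin 2)) (((2 : ℕ) : ℝ) * ((1 / 16 : ℝ) / 4))
          (isotropicPairWitness (d := 4) 2 τ (1 / 10)),
        IsMassiveState μ ∧ HasExponentialDecay (plaquetteCorrFn (fundamentalRep (Fin 2)) μ) := by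
  have hq : exp (Real.log (3 / 2)) = 3 / 2 := Real.exp_log (by norm_num)
  have hmem := memBallZdS_isotropicPairWitness (d := 4) (N := 2) (τ := τ) (κ := 1 / 10) (t := Real.log (3 / 2))
    (by norm_num) (by norm_num) (by norm_num) (by norm_num) (Real.log_nonneg (by norm_num)) (by rw [hq]; norm_num)
  rw [hq, numOrient_four] at hmem
  have hs := sqrt_two_ge
  have hs0 : (0 : ℝ) < Real.sqrt 2 := by linarith
  have hτ0 : 0 ≤ |τ| := abs_nonneg τ
  have hdiv : |τ| / Real.sqrt 2 ≤ (1 / 10000) / (141421 / 100000) := div_le_div₀ (by norm_num) hτ (by norm_num) hs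
  refine su2_massiveS_rowS32_1_16 (hmem.mono ?_ ?_)
  · push_cast; nlinarith
  · push_cast
    have heq : (16 : ℝ) * (4 - 1) * 6 * |τ| * (3 / 2) *
        (((1 + 1 / 10) / (1 - 1 / 10)) ^ 4 + ((1 + 1 / 10 * (3 / 2)) / (1 - 1 / 10 * (3 / 2))) ^ 4) / Real.sqrt 2 =
        16 * (4 - 1) * 6 * (3 / 2) *
        (((1 + 1 / 10) / (1 - 1 / 10)) ^ 4 + ((1 + 1 / 10 * (3 / 2)) / (1 - 1 / 10 * (3 / 2))) ^ 4) * (|τ| / Real.sqrt 2) := by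
      ring
    rw [heq]
    nlinarith [hdiv, div_nonneg hτ0 hs0.le]

/-- **NEW all-`N` clustering row for the isotropic member** (rb-p1's currency, hypothesis-free): for every `N ≥ 2`,
`SU(N)` on `ℤ⁴` at coupling `1/64` plus ALL plaquette-pair couplings `τ (1/10)^{‖x_p − x_q‖₁} (Re tr U_p/N)(Re tr U_q/N)`
with `|τ| ≤ 1/12000` has exactly one DLR state, exponentially clustering at rate `log (6/5)` — inside rb-p1's all-`N`
row `suN_rowS_1_64` (loads `a = 144 (11/9)⁴ |τ| ≤ 0.0268 ≤ 1/20`,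
`Λ = 288 (6/5) ((11/9)⁴ + (14/11)⁴) |τ|/√N ≤ 0.0989 ≤ 1/10` using `√N ≥ √2 ≥ 1.41421`). -/
theorem suN_isotropicPair_massGapS_1_64 (hN : 2 ≤ N) {τ : ℝ} (hτ : |τ| ≤ 1 / 12000) :
    PerturbedMassGapAtS 4 N (1 / 64 : ℝ) (isotropicPairWitness (d := 4) N τ (1 / 10)) := by
  have hq : exp (Real.log (6 / 5)) = 6 / 5 := Real.exp_log (by norm_num)
  have hmem := memBallZdS_isotropicPairWitness (d := 4) (N := N) (τ := τ) (κ := 1 / 10) (t := Real.log (6 / 5))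
    (by norm_num) (by omega) (by norm_num) (by norm_num) (Real.log_nonneg (by norm_num)) (by rw [hq]; norm_num)
  rw [hq, numOrient_four] at hmem
  have hN2 : (2 : ℝ) ≤ N := by exact_mod_cast hN
  have hs : (141421 / 100000 : ℝ) ≤ Real.sqrt N := sqrt_two_ge.trans (Real.sqrt_le_sqrt hN2)
  have hs0 : (0 : ℝ) < Real.sqrt N := by linarith
  have hτ0 : 0 ≤ |τ| := abs_nonneg τ
  have hdiv : |τ| / Real.sqrt N ≤ (1 / 12000) / (141421 / 100000) := div_le_div₀ (by norm_num) hτ (by norm_num) hs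
  refine suN_rowS_1_64 hN _ (hmem.mono ?_ ?_)
  · push_cast; nlinarith
  · push_cast
    have heq : (16 : ℝ) * (4 - 1) * 6 * |τ| * (6 / 5) *
        (((1 + 1 / 10) / (1 - 1 / 10)) ^ 4 + ((1 + 1 / 10 * (6 / 5)) / (1 - 1 / 10 * (6 / 5))) ^ 4) / Real.sqrt N =
        16 * (4 - 1) * 6 * (6 / 5) *
        (((1 + 1 / 10) / (1 - 1 / 10)) ^ 4 + ((1 + 1 / 10 * (6 / 5)) / (1 - 1 / 10 * (6 / 5))) ^ 4) * (|τ| / Real.sqrt N) := by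
      ring
    rw [heq]
    nlinarith [hdiv, div_nonneg hτ0 hs0.le]

/-- ★ **ALL `N ≥ 2`, HYPOTHESIS-FREE: the isotropic infinite-range member at coupling `1/64`, `|τ| ≤ 1/12000` —
every DLR state is MASSIVE** (rate `log (6/5)`; massive cell `suN_massiveS_rowS_1_64`, same loads as
`suN_isotropicPair_massGapS_1_64`). -/
theorem suN_isotropicPair_massive_1_64 (hN : 2 ≤ N) {τ : ℝ} (hτ : |τ| ≤ 1 / 12000) :
    (perturbedGibbsMeasuresS (d := 4) (fundamentalRep (Fin N)) ((N : ℝ) * (1 / 64))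
        (isotropicPairWitness (d := 4) N τ (1 / 10))).Nonempty ∧
      ∀ μ ∈ perturbedGibbsMeasuresS (d := 4) (fundamentalRep (Fin N)) ((N : ℝ) * (1 / 64))
          (isotropicPairWitness (d := 4) N τ (1 / 10)),
        IsMassiveState μ ∧ HasExponentialDecay (plaquetteCorrFn (fundamentalRep (Fin N)) μ) := by
  have hq : exp (Real.log (6 / 5)) = 6 / 5 := Real.exp_log (by norm_num)
  have hmem := memBallZdS_isotropicPairWitness (d := 4) (N := N) (τ := τ) (κ := 1 / 10) (t := Real.log (6 / 5))
    (by norm_num) (by omega) (by norm_num) (by norm_num) (Real.log_nonneg (by norm_num)) (by rw [hq]; norm_num)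
  rw [hq, numOrient_four] at hmem
  have hN2 : (2 : ℝ) ≤ N := by exact_mod_cast hN
  have hs : (141421 / 100000 : ℝ) ≤ Real.sqrt N := sqrt_two_ge.trans (Real.sqrt_le_sqrt hN2)
  have hs0 : (0 : ℝ) < Real.sqrt N := by linarith
  have hτ0 : 0 ≤ |τ| := abs_nonneg τ
  have hdiv : |τ| / Real.sqrt N ≤ (1 / 12000) / (141421 / 100000) := div_le_div₀ (by norm_num) hτ (by norm_num) hs
  refine suN_massiveS_rowS_1_64 hN (hmem.mono ?_ ?_)
  · push_cast; nlinarith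
  · push_cast
    have heq : (16 : ℝ) * (4 - 1) * 6 * |τ| * (6 / 5) *
        (((1 + 1 / 10) / (1 - 1 / 10)) ^ 4 + ((1 + 1 / 10 * (6 / 5)) / (1 - 1 / 10 * (6 / 5))) ^ 4) / Real.sqrt N =
        16 * (4 - 1) * 6 * (6 / 5) *
        (((1 + 1 / 10) / (1 - 1 / 10)) ^ 4 + ((1 + 1 / 10 * (6 / 5)) / (1 - 1 / 10 * (6 / 5))) ^ 4) * (|τ| / Real.sqrt N) := by
      ring
    rw [heq]
    nlinarith [hdiv, div_nonneg hτ0 hs0.le]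

/-! ### The superposed member (adjoint plaquette terms + axial plaquette pairs) -/

/-- ★ **The SUPERPOSED member at `β_W = 1/16`: every DLR state is MASSIVE** — `SU(2)` on `ℤ⁴` at Wilson coupling
`1/16` perturbed by `adjointWitness t + axialPairWitness 2 τ (1/10)` (Bhanot–Creutz-type adjoint plaquette terms
`t (Re tr U_p/2)²` PLUS the infinite-range axial plaquette-pair couplings), `|t| ≤ 1/1000`, `|τ| ≤ 1/500`: DLR states
exist and every DLR state is an Osterwalder–Seiler massive state (rate `log (3/2)`) with plaquette–plaquette decay —
by ADDING the loads (`MemBallZdS.add`) inside the massive cell `su2_massiveS_rowS32_1_16` (loads as in rb-p1's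
`su2_adjoint_add_axialPair_massGapS_1_16`: `a ≤ 0.0274`, `Λ ≤ 0.1681`). -/
theorem su2_adjoint_add_axialPair_massive_1_16 {t τ : ℝ} (ht : |t| ≤ 1 / 1000) (hτ : |τ| ≤ 1 / 500) :
    (perturbedGibbsMeasuresS (d := 4) (fundamentalRep (Fin 2)) (((2 : ℕ) : ℝ) * ((1 / 16 : ℝ) / 4))
        (adjointWitness (d := 4) (N := 2) t + axialPairWitness (d := 4) 2 τ (1 / 10))).Nonempty ∧
      ∀ μ ∈ perturbedGibbsMeasuresS (d := 4) (fundamentalRep (Fin 2)) (((2 : ℕ) : ℝ) * ((1 / 16 : ℝ) / 4))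
          (adjointWitness (d := 4) (N := 2) t + axialPairWitness (d := 4) 2 τ (1 / 10)),
        IsMassiveState μ ∧ HasExponentialDecay (plaquetteCorrFn (fundamentalRep (Fin 2)) μ) := by
  have hq : exp (Real.log (3 / 2)) = 3 / 2 := Real.exp_log (by norm_num)
  have hlog0 : 0 ≤ Real.log (3 / 2) := Real.log_nonneg (by norm_num)
  have hadj := memBallZdS_adjointWitness_dim4 t hlog0
  have hax := memBallZdS_axialPairWitness (d := 4) (N := 2) (τ := τ) (κ := 1 / 10) (t := Real.log (3 / 2))
    (by norm_num) (by norm_num) (by norm_num) (by norm_num) hlog0 (by rw [hq]; norm_num)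
  have hsum := hadj.add hax
  rw [hq] at hsum
  have hs := sqrt_two_ge
  have hs0 : (0 : ℝ) < Real.sqrt 2 := by linarith
  have ht0 : 0 ≤ |t| := abs_nonneg t
  have hτ0 : 0 ≤ |τ| := abs_nonneg τ
  have hdivt : |t| / Real.sqrt 2 ≤ (1 / 1000) / (141421 / 100000) := div_le_div₀ (by norm_num) ht (by norm_num) hs
  have hdivτ : |τ| / Real.sqrt 2 ≤ (1 / 500) / (141421 / 100000) := div_le_div₀ (by norm_num) hτ (by norm_num) hs
  refine su2_massiveS_rowS32_1_16 (hsum.mono ?_ ?_)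
  · push_cast; nlinarith
  · push_cast
    have heq : (3 : ℝ) / 2 * (48 * |t| / Real.sqrt 2) +
        16 * 4 * (4 - 1) * (|τ| / Real.sqrt 2) * (3 / 2) *
          (1 / 10 / (1 - 1 / 10) + 1 / 10 * (3 / 2) / (1 - 1 / 10 * (3 / 2))) =
        72 * (|t| / Real.sqrt 2) +
        16 * 4 * (4 - 1) * (3 / 2) * (1 / 10 / (1 - 1 / 10) + 1 / 10 * (3 / 2) / (1 - 1 / 10 * (3 / 2))) *
          (|τ| / Real.sqrt 2) := by ring
    rw [heq]
    nlinarith [hdivt, hdivτ, div_nonneg ht0 hs0.le, div_nonneg hτ0 hs0.le]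

end Summit.Ventures.YMGap.RobustBall

end
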